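import Mathlib
import HarnessLib
import Summits.MatrixMultiplication.MatrixMultiplication.Theorems.OutsiderSandwichExchange

/-!
# OutsiderSandwich — THE EXCHANGE RATE `r*` OF `cw₂` FOR `⟨2,2,2⟩`: the residual as a linear exchange
rate and the summit in exchange currency
(decomp-mm lens 4 «minimal counterexample / extremal reduction», gen 36, part 3/3: tensor level)

Route `route-MatrixMultiplication-OutsiderSandwich`; cut of record UNCHANGED:
`closes (h₁ : LaserTangency) (h₂ : LaserMergeOptimal) (h₃ : SummitIffLaserTangency) : ω(ℂ) = 2`,
`LaserMergeOptimal` (stmt-27897) the declared residual; theorem-only, definition-free support.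
Notation as in part 2: `T(ℂ)`, `≲`, `a = [⟨2,2,2⟩]`, `c = [cw₂]`, `X(T(ℂ))` the asymptotic spectrum.

§2 **LINEAR EXCHANGE AND THE RATE `r*`.**  The ratio `φ(a)/φ(c)` attains a maximum `r*` on the compact
   spectrum, and (part 1 §1 = Fritz's rate formula inside `T(ℂ)`, `isGLB_ratioMax`)

     `r* = max_{φ ∈ X} φ(a)/φ(c) = inf { p/q : q·[⟨2,2,2⟩] ≲ p·[cw₂] } ∈ [4/3, C*]`,  `C* = 2^{(2ω+2)/3}/3`,

   where the upper bound is pointwise real arithmetic from the laser floor `27φ(a) ≤ 4φ(c)³` and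
   `φ(a) ≤ R̃(a) = 2^ω`, with equality EXACTLY at tight-and-top points (`ratio_bound`).  Hence
   (`laserMergeOptimal_iff_linearExchange`, `_cubed`, `not_laserMergeOptimal_iff_cheapLinearExchange`,
   `exists_exchangeRate`, `summit_iff_floorOne_and_laserMergeOptimal`):

     `LaserMergeOptimal ⟺ r* = C* ⟺ ∀ p q, (q·[⟨2,2,2⟩] ≲ p·[cw₂]) → 4·4^ω·q³ ≤ 27·p³`,
     `¬LaserMergeOptimal ⟺ ∃ (p, q), 27p³ < 4·4^ω·q³ ∧ q·[⟨2,2,2⟩] ≲ p·[cw₂]`      (ONE cheap pair),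
     `FLOOR(1) of g31 ⟺ r* = 4/3`,      `ω = 2 ⟺ (3·[⟨2,2,2⟩] ≲ 4·[cw₂]) ∧ LaserMergeOptimal`

   (g31's dial `summit_iff_cwDial` at slopes `1/3 < 1` in exchange currency: the summit says the exchange
   «four `cw₂` for three `⟨2,2,2⟩`» is VALID, the residual says NO exchange beats the rate `C*` forced
   by the laser floor and `R̃(a) = 2^ω`; every exchange pays `p/q ≥ 4/3` at `ζ₁`).  The lens's normal
   form of `¬LaserMergeOptimal` is ONE PAIR `(p, q) ∈ ℕ²` and ONE restriction between multiples of two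
   FIXED tensors, `q` copies of `⟨2,2,2⟩` from `p` copies of `cw₂`.

Honest tags: support only (readings of the unchanged binder `h₂`; nothing finite is decided; the cubed
threshold `4·4^ω/27` carries `ω`, the square form of part 2 does not).
Nearest prior art: Fritz 2017 (arXiv:1504.03661) Thm. 8.24 (rate formula, abstract); g31
`OutsiderSandwichSlopeDialExchange` (the FLOOR side of the dial as inequalities `3^q·F(a)^p ≤ 4^p·F(c)^q`);
new here: the CAP side — the residual — as the statement «the rate `r*` equals its forced ceiling `C*`».
References: [cite: Strassen1988, Thm. 2.3–2.4, Thm. 3.8]; [cite: Zuiddam2018, Thm. 2.12, Cor. 2.13,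
Thm. 2.15]; [cite: CoppersmithWinograd1990, §6]; [cite: ChristandlVranaZuiddam2023, §1.2, Thm. 4.20].
-/

set_option linter.dupNamespace false

noncomputable section

namespace Summit.MatrixMultiplication.MatrixMultiplication.Theorems.OutsiderSandwichResidualRate

open Literature.Computability.AlgebraicComplexity
open Summit.MatrixMultiplication.MatrixMultiplication.Theses.OutsiderSandwich
open Summit.MatrixMultiplication.MatrixMultiplication.Theorems.OutsiderSandwichContactFace
  (gaugePoint₁_cwTensor_two gaugePoint₁_matMulTensor_two)
open Summit.MatrixMultiplication.MatrixMultiplication.Theorems.OutsiderSandwichSlopeDialCore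
  (SlopeFloor SlopeCap)
open Summit.MatrixMultiplication.MatrixMultiplication.Theorems.OutsiderSandwichSlopeDial
  (cwFloor_one_iff summit_iff_cwDial cwCap_third_iff)
open Summit.MatrixMultiplication.MatrixMultiplication.Theorems.OutsiderSandwichFaceCertificates
open Summit.MatrixMultiplication.MatrixMultiplication.Theorems.OutsiderSandwichBundledPrice
open Summit.MatrixMultiplication.MatrixMultiplication.Theorems.OutsiderSandwichSubsidy
open Summit.MatrixMultiplication.MatrixMultiplication.Theorems.OutsiderSandwichProductLocalisation
open Summit.MatrixMultiplication.MatrixMultiplication.Theorems.OutsiderSandwichExchange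

variable {F : SpectralMap ℂ}

/-! ## §2  The linear exchange and the rate `r* = max F⟨2,2,2⟩/F(cw₂)` -/

/-- **Pointwise lemma (real arithmetic).**  For `0 < m ≤ R`, `0 ≤ w`, `27m ≤ 4w³` and the threshold
`C > 0` with `27C³ = 4R²`:  `m ≤ C·w`, with equality iff `m = R` AND `27m = 4w³`. -/
theorem ratio_le_threshold {m w R C : ℝ} (hm : 0 < m) (hmR : m ≤ R) (hw : 0 ≤ w)
    (hfl : 27 * m ≤ 4 * w ^ 3) (hC : 0 < C) (hC3 : 27 * C ^ 3 = 4 * R ^ 2) :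
    m ≤ C * w ∧ (m = C * w ↔ m = R ∧ 27 * m = 4 * w ^ 3) := by
  have hm2 : m ^ 2 ≤ R ^ 2 := pow_le_pow_left₀ hm.le hmR 2
  have hR : 0 < R := lt_of_lt_of_le hm hmR
  have e : 27 * (C * w) ^ 3 = 4 * R ^ 2 * w ^ 3 := by rw [mul_pow, ← mul_assoc, hC3]
  have hprod := mul_le_mul hm2 hfl (by positivity) (by positivity)
  have hcube : 27 * m ^ 3 ≤ 27 * (C * w) ^ 3 := by
    have h27 : 27 * m ^ 3 = m ^ 2 * (27 * m) := by ring
    rw [h27, e]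
    linarith [hprod]
  have hle : m ≤ C * w :=
    (pow_le_pow_iff_left₀ hm.le (by positivity) three_ne_zero).1 (by linarith)
  refine ⟨hle, ?_⟩
  rw [← pow_left_inj₀ hm.le (by positivity) three_ne_zero]
  have key : m ^ 3 = (C * w) ^ 3 ↔ m ^ 2 * (27 * m) = R ^ 2 * (4 * w ^ 3) := by
    constructor <;> intro h <;> nlinarith [h, hC3]
  rw [key, mul_eq_mul_iff_eq_and_eq hm2 (by positivity) hfl (by positivity),
    pow_left_inj₀ hm.le hR.le two_ne_zero]

/-- `(2^{(2ω+2)/3})³ = 4·(2^ω)²`. -/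
theorem threshold_pow_three : ((2 : ℝ) ^ ((2 * omega ℂ + 2) / 3)) ^ 3 = 4 * ((2 : ℝ) ^ omega ℂ) ^ 2 := by
  have h1 : ((2 : ℝ) ^ ((2 * omega ℂ + 2) / 3)) ^ 3 = (2 : ℝ) ^ (2 * omega ℂ + 2) := by
    rw [← Real.rpow_natCast, ← Real.rpow_mul (by norm_num : (0 : ℝ) ≤ 2)]
    congr 1
    push_cast
    ring
  rw [h1, Real.rpow_add two_pos, show (2 : ℝ) * omega ℂ = omega ℂ * 2 by ring,
    Real.rpow_mul (by norm_num : (0 : ℝ) ≤ 2), Real.rpow_two, Real.rpow_two]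
  norm_num
  ring

/-- The threshold of `T(ℂ)`: `C* = 2^{(2ω+2)/3}/3` satisfies `27·C*³ = 4·(2^ω)²`. -/
theorem threshold_cube :
    27 * ((2 : ℝ) ^ ((2 * omega ℂ + 2) / 3) / 3) ^ 3 = 4 * ((2 : ℝ) ^ omega ℂ) ^ 2 := by
  rw [div_pow, threshold_pow_three]
  ring

/-- The threshold is positive. -/
theorem threshold_pos : 0 < (2 : ℝ) ^ ((2 * omega ℂ + 2) / 3) / 3 :=
  div_pos (Real.rpow_pos_of_pos two_pos _) three_pos

/-- **The ratio bound on `X(T(ℂ))`**: `φ(a) ≤ C*·φ(c)`, with equality iff `φ` is tight and top.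
[cite: CoppersmithWinograd1990, §6; Strassen1988, Thm. 3.8] -/
theorem ratio_bound (φ : TensorClass ℂ → ℝ) (hφ : IsSpectralPoint (fun x y : TensorClass ℂ => x ≤ y) φ) :
    φ (TensorClass.mk (matMulTensor ℂ 2 2 2)) ≤
        (2 : ℝ) ^ ((2 * omega ℂ + 2) / 3) / 3 * φ (TensorClass.mk (cwTensor ℂ 2)) ∧
      (φ (TensorClass.mk (matMulTensor ℂ 2 2 2)) =
          (2 : ℝ) ^ ((2 * omega ℂ + 2) / 3) / 3 * φ (TensorClass.mk (cwTensor ℂ 2)) ↔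
        φ (((27 : ℕ) : TensorClass ℂ) * TensorClass.mk (matMulTensor ℂ 2 2 2)) =
            φ (((4 : ℕ) : TensorClass ℂ) * TensorClass.mk (cwTensor ℂ 2) ^ 3) ∧
          φ (TensorClass.mk (matMulTensor ℂ 2 2 2)) = (2 : ℝ) ^ omega ℂ) := by
  obtain ⟨h1, h2⟩ := matMul_mem_Icc φ hφ
  have hfl := laserFloor_valid φ hφ
  rw [hφ.map_mul, hφ.map_mul, hφ.map_natCast, hφ.map_natCast, hφ.map_pow] at hfl
  push_cast at hfl
  obtain ⟨hle, hiff⟩ := ratio_le_threshold (lt_of_lt_of_le one_pos h1) h2 (cw_pos φ hφ).le hfl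
    threshold_pos threshold_cube
  refine ⟨hle, ?_⟩
  rw [hiff, face_iff hφ, and_comm]

/-- **THE RESIDUAL AS A LINEAR EXCHANGE RATE:**
`LaserMergeOptimal ⟺ ∀ p q, (q·[⟨2,2,2⟩] ≲ p·[cw₂]) → 2^{(2ω+2)/3}·q ≤ 3p`.
[cite: Zuiddam2018, Thm. 2.12, Thm. 2.15; CoppersmithWinograd1990, §6; Strassen1988, Thm. 3.8] -/
theorem laserMergeOptimal_iff_linearExchange :
    LaserMergeOptimal ↔ ∀ p q : ℕ,
      AsympLe (fun x y : TensorClass ℂ => x ≤ y)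
        ((q : TensorClass ℂ) * TensorClass.mk (matMulTensor ℂ 2 2 2))
        ((p : TensorClass ℂ) * TensorClass.mk (cwTensor ℂ 2)) →
      (2 : ℝ) ^ ((2 * omega ℂ + 2) / 3) * q ≤ 3 * p := by
  rw [laserMergeOptimal_iff_exists_tight_top,
    exists_tight_iff_abstract (fun s _ => s = (2 : ℝ) ^ omega ℂ)]
  have key := attains_iff_exchange (TensorClass.isStrassenPreorder ℂ)
    (x := TensorClass.mk (matMulTensor ℂ 2 2 2)) (y := TensorClass.mk (cwTensor ℂ 2))
    (C := (2 : ℝ) ^ ((2 * omega ℂ + 2) / 3) / 3)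
    (spectrum_nonempty_of_one_le (TensorClass.isStrassenPreorder ℂ) one_le_mk_matMul) cw_pos
    (fun φ hφ => (ratio_bound φ hφ).1)
  have lhs : (∃ φ : TensorClass ℂ → ℝ, IsSpectralPoint (fun x y : TensorClass ℂ => x ≤ y) φ ∧
      φ (((27 : ℕ) : TensorClass ℂ) * TensorClass.mk (matMulTensor ℂ 2 2 2)) =
        φ (((4 : ℕ) : TensorClass ℂ) * TensorClass.mk (cwTensor ℂ 2) ^ 3) ∧
      φ (TensorClass.mk (matMulTensor ℂ 2 2 2)) = (2 : ℝ) ^ omega ℂ) ↔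
      ∃ φ : TensorClass ℂ → ℝ, IsSpectralPoint (fun x y : TensorClass ℂ => x ≤ y) φ ∧
        φ (TensorClass.mk (matMulTensor ℂ 2 2 2)) =
          (2 : ℝ) ^ ((2 * omega ℂ + 2) / 3) / 3 * φ (TensorClass.mk (cwTensor ℂ 2)) :=
    exists_congr fun φ => and_congr_right fun hφ => ((ratio_bound φ hφ).2).symm
  rw [lhs, key]
  refine forall_congr' fun p => forall_congr' fun q => imp_congr_right fun _ => ?_
  rw [div_mul_eq_mul_div, div_le_iff₀ (three_pos : (0 : ℝ) < 3), mul_comm (p : ℝ) 3]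

/-- **Integer form (cubed)**: `LaserMergeOptimal ⟺ ∀ p q, (q·a ≲ p·c) → 4·(2^ω)²·q³ ≤ 27·p³`.
[cite: Zuiddam2018, Thm. 2.12, Thm. 2.15; CoppersmithWinograd1990, §6; Strassen1988, Thm. 3.8] -/
theorem laserMergeOptimal_iff_linearExchange_cubed :
    LaserMergeOptimal ↔ ∀ p q : ℕ,
      AsympLe (fun x y : TensorClass ℂ => x ≤ y)
        ((q : TensorClass ℂ) * TensorClass.mk (matMulTensor ℂ 2 2 2))
        ((p : TensorClass ℂ) * TensorClass.mk (cwTensor ℂ 2)) →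
      4 * ((2 : ℝ) ^ omega ℂ) ^ 2 * (q : ℝ) ^ 3 ≤ 27 * (p : ℝ) ^ 3 := by
  rw [laserMergeOptimal_iff_linearExchange]
  refine forall_congr' fun p => forall_congr' fun q => imp_congr_right fun _ => ?_
  have h0 : 0 ≤ (2 : ℝ) ^ ((2 * omega ℂ + 2) / 3) * q :=
    mul_nonneg (Real.rpow_nonneg (by norm_num) _) (Nat.cast_nonneg q)
  rw [← pow_le_pow_iff_left₀ h0 (by positivity : (0 : ℝ) ≤ 3 * p) three_ne_zero]
  have e : ((2 : ℝ) ^ ((2 * omega ℂ + 2) / 3) * q) ^ 3 = 4 * ((2 : ℝ) ^ omega ℂ) ^ 2 * (q : ℝ) ^ 3 := by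
    rw [mul_pow, threshold_pow_three]
  rw [e]
  constructor <;> intro h <;> nlinarith [h]

/-- **Normal form, linear**: `¬LaserMergeOptimal ⟺ ∃ p q, 27p³ < 4·(2^ω)²·q³ ∧ q·[⟨2,2,2⟩] ≲ p·[cw₂]`.
[cite: Zuiddam2018, Thm. 2.12, Thm. 2.15; CoppersmithWinograd1990, §6; Strassen1988, Thm. 3.8] -/
theorem not_laserMergeOptimal_iff_cheapLinearExchange :
    ¬ LaserMergeOptimal ↔ ∃ p q : ℕ, 27 * (p : ℝ) ^ 3 < 4 * ((2 : ℝ) ^ omega ℂ) ^ 2 * (q : ℝ) ^ 3 ∧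
      AsympLe (fun x y : TensorClass ℂ => x ≤ y)
        ((q : TensorClass ℂ) * TensorClass.mk (matMulTensor ℂ 2 2 2))
        ((p : TensorClass ℂ) * TensorClass.mk (cwTensor ℂ 2)) := by
  rw [laserMergeOptimal_iff_linearExchange_cubed]
  push Not
  refine exists_congr fun p => exists_congr fun q => ?_
  rw [and_comm]

/-- **Every linear exchange pays at least `4/3`**: `4q ≤ 3p` (at `ζ₁`). [cite: Strassen1988, Thm. 3.8] -/
theorem four_mul_le_three_mul_of_linearExchange {p q : ℕ}
    (hc : AsympLe (fun x y : TensorClass ℂ => x ≤ y)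
      ((q : TensorClass ℂ) * TensorClass.mk (matMulTensor ℂ 2 2 2))
      ((p : TensorClass ℂ) * TensorClass.mk (cwTensor ℂ 2))) :
    4 * q ≤ 3 * p := by
  have hF := gaugePoint₁_isUniversalSpectralPoint ℂ
  have hφ := TensorClass.isSpectralPoint_eval hF
  have h1 := ((TensorClass.isStrassenPreorder ℂ).asympLe_iff_forall_spectralPoint.1 hc) _ hφ
  simp only [hφ.map_mul, hφ.map_natCast, TensorClass.eval_mk hF, gaugePoint₁_matMulTensor_two,
    gaugePoint₁_cwTensor_two] at h1
  have h' : ((4 * q : ℕ) : ℝ) ≤ ((3 * p : ℕ) : ℝ) := by push_cast; linarith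
  exact_mod_cast h'

/-- **THE EXCHANGE RATE `r*` OF `cw₂` FOR `⟨2,2,2⟩`.**  There is `φ₀ ∈ X(T(ℂ))` maximising
`φ(a)/φ(c)`; its value `r*` is the infimum of the linear exchange rates, lies in `[4/3, 2^{(2ω+2)/3}/3]`,
equals the upper end iff `LaserMergeOptimal`, and equals `4/3` iff g31's `FLOOR(1)` (`3F(a) ≤ 4F(c)`
for all universal `F`). [cite: Zuiddam2018, Thm. 2.12, Cor. 2.13, Thm. 2.15; Strassen1988, Thm. 3.8] -/
theorem exists_exchangeRate :
    ∃ φ₀ : TensorClass ℂ → ℝ, IsSpectralPoint (fun x y : TensorClass ℂ => x ≤ y) φ₀ ∧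
      (∀ ψ, IsSpectralPoint (fun x y : TensorClass ℂ => x ≤ y) ψ →
        ψ (TensorClass.mk (matMulTensor ℂ 2 2 2)) / ψ (TensorClass.mk (cwTensor ℂ 2)) ≤
          φ₀ (TensorClass.mk (matMulTensor ℂ 2 2 2)) / φ₀ (TensorClass.mk (cwTensor ℂ 2))) ∧
      IsGLB {t : ℝ | ∃ p q : ℕ, 0 < q ∧ t = (p : ℝ) / q ∧
          AsympLe (fun x y : TensorClass ℂ => x ≤ y)
            ((q : TensorClass ℂ) * TensorClass.mk (matMulTensor ℂ 2 2 2))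
            ((p : TensorClass ℂ) * TensorClass.mk (cwTensor ℂ 2))}
        (φ₀ (TensorClass.mk (matMulTensor ℂ 2 2 2)) / φ₀ (TensorClass.mk (cwTensor ℂ 2))) ∧
      4 / 3 ≤ φ₀ (TensorClass.mk (matMulTensor ℂ 2 2 2)) / φ₀ (TensorClass.mk (cwTensor ℂ 2)) ∧
      φ₀ (TensorClass.mk (matMulTensor ℂ 2 2 2)) / φ₀ (TensorClass.mk (cwTensor ℂ 2)) ≤
        (2 : ℝ) ^ ((2 * omega ℂ + 2) / 3) / 3 ∧
      (LaserMergeOptimal ↔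
        φ₀ (TensorClass.mk (matMulTensor ℂ 2 2 2)) / φ₀ (TensorClass.mk (cwTensor ℂ 2)) =
          (2 : ℝ) ^ ((2 * omega ℂ + 2) / 3) / 3) ∧
      (SlopeFloor (cwTensor ℂ 2) (Real.logb 2 3) 1 ↔
        φ₀ (TensorClass.mk (matMulTensor ℂ 2 2 2)) / φ₀ (TensorClass.mk (cwTensor ℂ 2)) ≤ 4 / 3) := by
  have hS := TensorClass.isStrassenPreorder ℂ
  obtain ⟨φ₀, hφ₀, hmax⟩ := exists_isMaxOn_ratio hS (TensorClass.mk (matMulTensor ℂ 2 2 2))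
    (spectrum_nonempty_of_one_le hS one_le_mk_matMul) cw_pos
  have hc0 := cw_pos φ₀ hφ₀
  refine ⟨φ₀, hφ₀, hmax, isGLB_ratioMax hS cw_pos hφ₀ hmax, ?_, ?_, ?_, ?_⟩
  · -- `ζ₁` has ratio `4/3`
    have hF := gaugePoint₁_isUniversalSpectralPoint ℂ
    have h1 := hmax _ (TensorClass.isSpectralPoint_eval hF)
    rwa [TensorClass.eval_mk hF, TensorClass.eval_mk hF, gaugePoint₁_matMulTensor_two,
      gaugePoint₁_cwTensor_two] at h1
  · rw [div_le_iff₀ hc0]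
    exact (ratio_bound φ₀ hφ₀).1
  · rw [laserMergeOptimal_iff_exists_tight_top,
      exists_tight_iff_abstract (fun s _ => s = (2 : ℝ) ^ omega ℂ)]
    constructor
    · rintro ⟨φ, hφ, hface, htop⟩
      have he := ((ratio_bound φ hφ).2).2 ⟨hface, htop⟩
      refine le_antisymm (by rw [div_le_iff₀ hc0]; exact (ratio_bound φ₀ hφ₀).1) ?_
      have h1 := hmax φ hφ
      rw [he, mul_div_assoc, div_self (cw_pos φ hφ).ne', mul_one] at h1
      exact h1
    · intro he
      rw [div_eq_iff hc0.ne'] at he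
      exact ⟨φ₀, hφ₀, ((ratio_bound φ₀ hφ₀).2).1 he⟩
  · rw [cwFloor_one_iff, forall_univ_iff_abstract (fun s t => 3 * s ≤ 4 * t)]
    constructor
    · intro H
      rw [div_le_div_iff₀ hc0 three_pos]
      linarith [H φ₀ hφ₀]
    · intro H ψ hψ
      have h1 := (hmax ψ hψ).trans H
      rw [div_le_div_iff₀ (cw_pos ψ hψ) three_pos] at h1
      linarith

/-- **THE SQUARE RATE `σ*`.**  The ratio `φ(27a²)/φ(4c³)` attains a maximum `σ*` on `X(T(ℂ))`;
`σ* = inf { p/q : q·27[⟨2,2,2⟩]² ≲ p·4[cw₂]³ } ∈ [4, 2^ω]`, and `LaserMergeOptimal ⟺ σ* = 2^ω`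
(the residual says: squares of `⟨2,2,2⟩` are never cheaper, per copy of `⟨2,2,2⟩`, in laser-floor
currency than `⟨2,2,2⟩` is in diagonal currency). [cite: Zuiddam2018, Thm. 2.12, Cor. 2.13, Thm. 2.15;
CoppersmithWinograd1990, §6; Strassen1988, Thm. 3.8] -/
theorem exists_squareRate :
    ∃ φ₀ : TensorClass ℂ → ℝ, IsSpectralPoint (fun x y : TensorClass ℂ => x ≤ y) φ₀ ∧
      (∀ ψ, IsSpectralPoint (fun x y : TensorClass ℂ => x ≤ y) ψ →
        ψ (((27 : ℕ) : TensorClass ℂ) * TensorClass.mk (matMulTensor ℂ 2 2 2) ^ 2) /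
            ψ (((4 : ℕ) : TensorClass ℂ) * TensorClass.mk (cwTensor ℂ 2) ^ 3) ≤
          φ₀ (((27 : ℕ) : TensorClass ℂ) * TensorClass.mk (matMulTensor ℂ 2 2 2) ^ 2) /
            φ₀ (((4 : ℕ) : TensorClass ℂ) * TensorClass.mk (cwTensor ℂ 2) ^ 3)) ∧
      IsGLB {t : ℝ | ∃ p q : ℕ, 0 < q ∧ t = (p : ℝ) / q ∧
          AsympLe (fun x y : TensorClass ℂ => x ≤ y)
            ((q : TensorClass ℂ) * (((27 : ℕ) : TensorClass ℂ) * TensorClass.mk (matMulTensor ℂ 2 2 2) ^ 2))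
            ((p : TensorClass ℂ) * (((4 : ℕ) : TensorClass ℂ) * TensorClass.mk (cwTensor ℂ 2) ^ 3))}
        (φ₀ (((27 : ℕ) : TensorClass ℂ) * TensorClass.mk (matMulTensor ℂ 2 2 2) ^ 2) /
          φ₀ (((4 : ℕ) : TensorClass ℂ) * TensorClass.mk (cwTensor ℂ 2) ^ 3)) ∧
      4 ≤ φ₀ (((27 : ℕ) : TensorClass ℂ) * TensorClass.mk (matMulTensor ℂ 2 2 2) ^ 2) /
          φ₀ (((4 : ℕ) : TensorClass ℂ) * TensorClass.mk (cwTensor ℂ 2) ^ 3) ∧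
      φ₀ (((27 : ℕ) : TensorClass ℂ) * TensorClass.mk (matMulTensor ℂ 2 2 2) ^ 2) /
          φ₀ (((4 : ℕ) : TensorClass ℂ) * TensorClass.mk (cwTensor ℂ 2) ^ 3) ≤ (2 : ℝ) ^ omega ℂ ∧
      (LaserMergeOptimal ↔
        φ₀ (((27 : ℕ) : TensorClass ℂ) * TensorClass.mk (matMulTensor ℂ 2 2 2) ^ 2) /
          φ₀ (((4 : ℕ) : TensorClass ℂ) * TensorClass.mk (cwTensor ℂ 2) ^ 3) = (2 : ℝ) ^ omega ℂ) := by
  have hS := TensorClass.isStrassenPreorder ℂ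
  -- the square ratio in coordinates, and its pointwise bound `≤ φ(a) ≤ 2^ω`
  have hv : ∀ ψ : TensorClass ℂ → ℝ, IsSpectralPoint (fun x y : TensorClass ℂ => x ≤ y) ψ →
      0 < ψ (((4 : ℕ) : TensorClass ℂ) * TensorClass.mk (cwTensor ℂ 2) ^ 3) := by
    intro ψ hψ
    rw [hψ.map_mul, hψ.map_natCast, hψ.map_pow]
    have := cw_pos ψ hψ
    positivity
  have hpt : ∀ ψ : TensorClass ℂ → ℝ, IsSpectralPoint (fun x y : TensorClass ℂ => x ≤ y) ψ →
      ψ (((27 : ℕ) : TensorClass ℂ) * TensorClass.mk (matMulTensor ℂ 2 2 2) ^ 2) /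
          ψ (((4 : ℕ) : TensorClass ℂ) * TensorClass.mk (cwTensor ℂ 2) ^ 3) ≤
        ψ (TensorClass.mk (matMulTensor ℂ 2 2 2)) ∧
      (ψ (((27 : ℕ) : TensorClass ℂ) * TensorClass.mk (matMulTensor ℂ 2 2 2) ^ 2) /
          ψ (((4 : ℕ) : TensorClass ℂ) * TensorClass.mk (cwTensor ℂ 2) ^ 3) = (2 : ℝ) ^ omega ℂ ↔
        ψ (((27 : ℕ) : TensorClass ℂ) * TensorClass.mk (matMulTensor ℂ 2 2 2)) =
            ψ (((4 : ℕ) : TensorClass ℂ) * TensorClass.mk (cwTensor ℂ 2) ^ 3) ∧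
          ψ (TensorClass.mk (matMulTensor ℂ 2 2 2)) = (2 : ℝ) ^ omega ℂ) := by
    intro ψ hψ
    have hv' := hv ψ hψ
    obtain ⟨h1, h2⟩ := matMul_mem_Icc ψ hψ
    have hfl := laserFloor_valid ψ hψ
    rw [hψ.map_mul, hψ.map_mul, hψ.map_natCast, hψ.map_natCast, hψ.map_pow] at hfl ⊢
    rw [hψ.map_mul, hψ.map_natCast, hψ.map_pow] at hv' ⊢
    push_cast at hfl hv' ⊢
    have hm : 0 < ψ (TensorClass.mk (matMulTensor ℂ 2 2 2)) := lt_of_lt_of_le one_pos h1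
    refine ⟨by rw [div_le_iff₀ hv']; nlinarith, ?_⟩
    rw [div_eq_iff hv'.ne']
    constructor
    · intro he
      -- `27ψ(a)² = 2^ω·4ψ(c)³ ≥ ψ(a)·4ψ(c)³ ≥ 27ψ(a)²` forces both equalities
      have htop : ψ (TensorClass.mk (matMulTensor ℂ 2 2 2)) = (2 : ℝ) ^ omega ℂ := by
        by_contra hne
        have hlt := lt_of_le_of_ne h2 hne
        nlinarith [mul_lt_mul_of_pos_right hlt hv']
      refine ⟨?_, htop⟩
      rw [htop] at he ⊢
      nlinarith
    · rintro ⟨hface, htop⟩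
      rw [htop] at hface ⊢
      nlinarith [hface]
  obtain ⟨φ₀, hφ₀, hmax⟩ := exists_isMaxOn_ratio hS
    (((27 : ℕ) : TensorClass ℂ) * TensorClass.mk (matMulTensor ℂ 2 2 2) ^ 2)
    (spectrum_nonempty_of_one_le hS one_le_mk_matMul) hv
  refine ⟨φ₀, hφ₀, hmax, isGLB_ratioMax hS hv hφ₀ hmax, ?_, ((hpt φ₀ hφ₀).1).trans (matMul_mem_Icc φ₀ hφ₀).2,
    ?_⟩
  · -- `ζ₁`: `27·16/(4·27) = 4`
    have hF := gaugePoint₁_isUniversalSpectralPoint ℂ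
    have hφ := TensorClass.isSpectralPoint_eval hF
    have h1 := hmax _ hφ
    rw [hφ.map_mul, hφ.map_mul, hφ.map_natCast, hφ.map_natCast, hφ.map_pow, hφ.map_pow,
      TensorClass.eval_mk hF, TensorClass.eval_mk hF, gaugePoint₁_matMulTensor_two,
      gaugePoint₁_cwTensor_two] at h1
    norm_num at h1
    exact h1
  · rw [laserMergeOptimal_iff_exists_tight_top,
      exists_tight_iff_abstract (fun s _ => s = (2 : ℝ) ^ omega ℂ)]
    constructor
    · rintro ⟨φ, hφ, hface, htop⟩
      have he := ((hpt φ hφ).2).2 ⟨hface, htop⟩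
      exact le_antisymm (((hpt φ₀ hφ₀).1).trans (matMul_mem_Icc φ₀ hφ₀).2) (he ▸ hmax φ hφ)
    · intro he
      exact ⟨φ₀, hφ₀, ((hpt φ₀ hφ₀).2).1 he⟩

/-- **THE SUMMIT IN EXCHANGE CURRENCY** (g31's dial at slopes `1/3 < 1`):
`ω = 2 ⟺ (3·[⟨2,2,2⟩] ≲ 4·[cw₂]) ∧ LaserMergeOptimal` — the exchange «four `cw₂` for three `⟨2,2,2⟩`»
is VALID and the residual holds. [cite: Strassen1988, Thm. 2.3–2.4, Thm. 3.8; CoppersmithWinograd1990, §6] -/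
theorem summit_iff_floorOne_and_laserMergeOptimal :
    _root_.MatrixMultiplication ↔
      AsympLe (fun x y : TensorClass ℂ => x ≤ y)
        (((3 : ℕ) : TensorClass ℂ) * TensorClass.mk (matMulTensor ℂ 2 2 2))
        (((4 : ℕ) : TensorClass ℂ) * TensorClass.mk (cwTensor ℂ 2)) ∧ LaserMergeOptimal := by
  rw [summit_iff_cwDial (show (1 : ℝ) / 3 < 1 by norm_num), cwCap_third_iff, cwFloor_one_iff,
    forall_univ_iff_abstract (fun s t => 3 * s ≤ 4 * t),
    exchange_iff_forall (TensorClass.isStrassenPreorder ℂ)]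
  push_cast
  exact Iff.rfl

end Summit.MatrixMultiplication.MatrixMultiplication.Theorems.OutsiderSandwichResidualRate

end
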